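import Mathlib
import HarnessLib
import Literature.MathematicalPhysics.QuantumFieldTheory.ConstructiveQFTWave0
import Literature.MathematicalPhysics.QuantumLattice.AbelianFieldTensor
import Literature.MathematicalPhysics.QuantumLattice.AbelianMagneticFlux
import Literature.MathematicalPhysics.QuantumLattice.AbelianBianchiIdentity
import Summits.Ventures.LatticeQCDFlow.Scaling.TopologicalCollar
import Summits.Ventures.LatticeQCDFlow.Scaling.FluxSectorCollar
import Summits.Ventures.LatticeQCDFlow.Scaling.FluxSmallSteps
import Summits.Ventures.LatticeQCDFlow.Scaling.SliceTwistWitness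
import Summits.Ventures.LatticeQCDFlow.Scaling.RowFields
import Summits.Ventures.LatticeQCDFlow.Scaling.ThinSectorsConnected
import Summits.Ventures.LatticeQCDFlow.Scaling.TorusCochain
import Summits.Ventures.LatticeQCDFlow.Scaling.TorusPoincareLemma
import Summits.Ventures.LatticeQCDFlow.Scaling.MonopoleNumber
import Summits.Ventures.LatticeQCDFlow.Scaling.MonopoleSectors
import Summits.Ventures.LatticeQCDFlow.Scaling.MonopoleCrystal

/-!
# The monopole crystal in every dimension `d ≥ 3`: C10 (d) by trivial extension

HONEST FRAMING: exact (Metropolis-corrected) sampling algorithms for lattice gauge theory;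
figures of merit are autocorrelation/cost numbers at stated couplings and volumes; no
continuum-physics claim.

Venture `LatticeQCDFlow` (cell pub-lqcd), topic `Scaling`, FANOUT row 29 (theory2, gen-23), item 115
(after 114 `Scaling/MonopoleCrystal`, 113a/113b `Scaling/MonopoleNumber`, `Scaling/MonopoleSectors`,
112a/112b `Scaling/TorusCochain`, `Scaling/TorusPoincareLemma`).  NEW WORK; nothing here is cited as
a fact.  LITERATURE STATUS (honest): elementary bookkeeping; the only content is that a
configuration on the `3`-torus extended trivially (links `= 1`) in `d − 3` further periodic
directions keeps its plaquettes, field tensor, monopole numbers and fluxes in the first three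
directions and is trivial in all others.  Grade: formalisation; no new theorem of physics.

CONTENTS.  §1 `proj3 hd x` (the first three coordinates of a site, `hd : 3 ≤ d`) and the TRIVIAL
EXTENSION `extend3 hd U` of `U : GaugeConfig 3 L Circle` (pull back along `proj3` on links in
directions `0,1,2`, value `1` on all other links); `proj3` intertwines translations in the first
three directions and forgets the others (`proj3_add_single_castLE`, `proj3_add_single_of_le`);
plaquettes (`plaquetteHolonomy_extend3_castLE`, `…_of_le_left/right`), field tensor, thinness
(`extend3_mem_thinSet`), monopole numbers (`monopole_extend3`) and fluxes
(`topCharge_extend3_castLE`, `topCharge_extend3_eq_zero`) of the extension.  §2 THE LIFTED CRYSTAL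
`crystalLift hd hL = extend3 hd (crystal hL)` (`L` even): `ε`-thin exactly for `ε > 1`
(`crystalLift_mem_thinSet_iff`), monopole number `χ = ±1` on every cube spanned by the first three
directions (`monopole_crystalLift`), all fluxes zero at every base point (`topCharge_crystalLift`),
hence — by the sector invariance of monopole numbers, item 113a — outside the `ε`-sector of the
vacuum for every `ε ≤ 2` (`crystalLift_not_mem_connectedComponentIn_one`).  Consequences:
`exists_thin_sameFlux_not_connected_of_le` (in every `d ≥ 3`, every even `L ≥ 2`, every
`1 < ε ≤ 2`: two `ε`-thin configurations with all fluxes equal, monopole numbers different, in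
different connected components of `ThinSet d L ε` — the `ε`-sector partition is strictly finer
than the flux partition, so the threshold `ε = 1` of item 113b
`mem_connectedComponentIn_thin_iff_of_le_one` cannot be raised in any `d ≥ 3`), and the closed
statement `MonopoleThresholdSharp` / `monopoleThresholdSharp` (conjecture C10 (d) of the cell's
THEORY-2 §4 for even volumes; odd `L ≥ 5` needs a local monopole–antimonopole pair instead of the
crystal and is not formalised).  In `d = 2` there are no cubes and no such refinement (item 110,
`Scaling/ThinSectorsConnected`: the `ε`-sectors ARE the flux sectors for every `ε ≤ 2`).

No `sorry`, no new axioms, no `opaque`; standard axioms only.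
-/

noncomputable section

namespace Summit.Ventures.LatticeQCDFlow.Theory2.Lattice.Flux.MonopoleSectors

open Metric Set Filter Topology Real Finset
open Literature.MathematicalPhysics.QuantumFieldTheory Literature.MathematicalPhysics.QuantumLattice
open Summit.Ventures.LatticeQCDFlow.Theory2.Lattice.Flux.TorusCochain

variable {d L : ℕ}

/-! ## §1. Trivial extension of a three-dimensional configuration to `d ≥ 3` dimensions -/

/-- The first three coordinates of a site of the `d`-torus, `d ≥ 3`. [folklore] -/
def proj3 (hd : 3 ≤ d) (x : Site d L) : Site 3 L := fun i => x (Fin.castLE hd i)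

/-- **Trivial extension**: a `U(1)` configuration on the `3`-torus, pulled back along `proj3` on the
links in the first three directions and set to `1` on all other links. [folklore] -/
def extend3 (hd : 3 ≤ d) (U : GaugeConfig 3 L Circle) : GaugeConfig d L Circle :=
  fun e => if h : (e.2 : ℕ) < 3 then U (proj3 hd e.1, ⟨e.2, h⟩) else 1

/-- `proj3` intertwines translations in the first three directions. [folklore] -/
theorem proj3_add_single_castLE (hd : 3 ≤ d) (x : Site d L) (i : Fin 3) (s : ZMod L) :
    proj3 hd (x + Pi.single (Fin.castLE hd i) s) = proj3 hd x + Pi.single i s := by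
  funext j
  simp [proj3, Pi.single_apply, (Fin.castLE_injective hd).eq_iff]

/-- `proj3` forgets translations in the other directions. [folklore] -/
theorem proj3_add_single_of_le (hd : 3 ≤ d) (x : Site d L) {μ : Fin d} (hμ : 3 ≤ (μ : ℕ))
    (s : ZMod L) : proj3 hd (x + Pi.single μ s) = proj3 hd x := by
  funext j
  have hne : Fin.castLE hd j ≠ μ := fun h => by
    have h' := congrArg Fin.val h
    simp at h'
    omega
  simp [proj3, hne]

/-- `proj3` of a shift in one of the first three directions. [folklore] -/
theorem proj3_shift_castLE (hd : 3 ≤ d) (x : Site d L) (i : Fin 3) :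
    proj3 hd (x.shift (Fin.castLE hd i)) = (proj3 hd x).shift i :=
  proj3_add_single_castLE hd x i 1

/-- `proj3` of a shift in another direction. [folklore] -/
theorem proj3_shift_of_le (hd : 3 ≤ d) (x : Site d L) {μ : Fin d} (hμ : 3 ≤ (μ : ℕ)) :
    proj3 hd (x.shift μ) = proj3 hd x :=
  proj3_add_single_of_le hd x hμ 1

/-- The extension on a link in one of the first three directions. [folklore] -/
theorem extend3_apply_castLE (hd : 3 ≤ d) (U : GaugeConfig 3 L Circle) (x : Site d L) (i : Fin 3) :
    extend3 hd U (x, Fin.castLE hd i) = U (proj3 hd x, i) := by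
  unfold extend3
  rw [dif_pos (show ((Fin.castLE hd i : Fin d) : ℕ) < 3 from i.2)]
  rfl

/-- The extension on any other link is `1`. [folklore] -/
theorem extend3_apply_of_le (hd : 3 ≤ d) (U : GaugeConfig 3 L Circle) (x : Site d L) {μ : Fin d}
    (hμ : 3 ≤ (μ : ℕ)) : extend3 hd U (x, μ) = 1 := by
  unfold extend3
  rw [dif_neg (show ¬ ((μ : ℕ) < 3) by omega)]

/-- An index below `3` is the image of an index of `Fin 3`. [folklore] -/
theorem exists_eq_castLE (hd : 3 ≤ d) {μ : Fin d} (hμ : (μ : ℕ) < 3) :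
    ∃ i : Fin 3, μ = Fin.castLE hd i :=
  ⟨⟨μ, hμ⟩, rfl⟩

/-- **Plaquettes in the first three directions are the plaquettes of the original field.**
[folklore] -/
theorem plaquetteHolonomy_extend3_castLE (hd : 3 ≤ d) (U : GaugeConfig 3 L Circle) (x : Site d L)
    (i j : Fin 3) : plaquetteHolonomy (extend3 hd U) x (Fin.castLE hd i) (Fin.castLE hd j) =
      plaquetteHolonomy U (proj3 hd x) i j := by
  simp only [plaquetteHolonomy, extend3_apply_castLE, proj3_shift_castLE]

/-- **All other plaquettes are trivial** (first index outside the first three). [folklore] -/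
theorem plaquetteHolonomy_extend3_of_le_left (hd : 3 ≤ d) (U : GaugeConfig 3 L Circle) (x : Site d L)
    {μ : Fin d} (hμ : 3 ≤ (μ : ℕ)) (ν : Fin d) : plaquetteHolonomy (extend3 hd U) x μ ν = 1 := by
  by_cases hν : (ν : ℕ) < 3
  · obtain ⟨j, rfl⟩ := exists_eq_castLE hd hν
    simp only [plaquetteHolonomy, extend3_apply_of_le hd U _ hμ, extend3_apply_castLE,
      proj3_shift_of_le hd x hμ]
    simp
  · simp only [plaquetteHolonomy, extend3_apply_of_le hd U _ hμ,
      extend3_apply_of_le hd U _ (not_lt.mp hν)]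
    simp

/-- **All other plaquettes are trivial** (second index outside the first three). [folklore] -/
theorem plaquetteHolonomy_extend3_of_le_right (hd : 3 ≤ d) (U : GaugeConfig 3 L Circle)
    (x : Site d L) (μ : Fin d) {ν : Fin d} (hν : 3 ≤ (ν : ℕ)) :
    plaquetteHolonomy (extend3 hd U) x μ ν = 1 := by
  by_cases hμ : (μ : ℕ) < 3
  · obtain ⟨i, rfl⟩ := exists_eq_castLE hd hμ
    simp only [plaquetteHolonomy, extend3_apply_of_le hd U _ hν, extend3_apply_castLE,
      proj3_shift_of_le hd x hν]
    simp
  · exact plaquetteHolonomy_extend3_of_le_left hd U x (not_lt.mp hμ) ν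

/-- The field tensor in the first three directions is the original one. [folklore] -/
theorem abelianFieldTensor_extend3_castLE (hd : 3 ≤ d) (U : GaugeConfig 3 L Circle) (x : Site d L)
    (i j : Fin 3) : abelianFieldTensor (extend3 hd U) x (Fin.castLE hd i) (Fin.castLE hd j) =
      abelianFieldTensor U (proj3 hd x) i j := by
  simp only [abelianFieldTensor, plaquetteHolonomy_extend3_castLE]

/-- The field tensor vanishes on all other index pairs. [folklore] -/
theorem abelianFieldTensor_extend3_eq_zero (hd : 3 ≤ d) (U : GaugeConfig 3 L Circle) (x : Site d L)
    {μ ν : Fin d} (h : 3 ≤ (μ : ℕ) ∨ 3 ≤ (ν : ℕ)) : abelianFieldTensor (extend3 hd U) x μ ν = 0 := by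
  rcases h with h | h
  · simp [abelianFieldTensor, plaquetteHolonomy_extend3_of_le_left hd U x h]
  · simp [abelianFieldTensor, plaquetteHolonomy_extend3_of_le_right hd U x μ h]

/-- **Thinness is preserved by trivial extension** (`ε > 0`). [folklore] -/
theorem extend3_mem_thinSet (hd : 3 ≤ d) {ε : ℝ} (hε : 0 < ε) {U : GaugeConfig 3 L Circle}
    (hU : U ∈ ThinSet 3 L ε) : extend3 hd U ∈ ThinSet d L ε := by
  rintro ⟨x, ⟨⟨μ, ν⟩, hlt⟩⟩
  by_cases hμ : (μ : ℕ) < 3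
  · by_cases hν : (ν : ℕ) < 3
    · obtain ⟨i, rfl⟩ := exists_eq_castLE hd hμ
      obtain ⟨j, rfl⟩ := exists_eq_castLE hd hν
      have hij : i < j := hlt
      show dist (plaquetteHolonomy (extend3 hd U) x (Fin.castLE hd i) (Fin.castLE hd j)) 1 < ε
      rw [plaquetteHolonomy_extend3_castLE]
      exact hU ⟨proj3 hd x, ⟨(i, j), hij⟩⟩
    · show dist (plaquetteHolonomy (extend3 hd U) x μ ν) 1 < ε
      rw [plaquetteHolonomy_extend3_of_le_right hd U x μ (not_lt.mp hν), dist_self]; exact hε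
  · show dist (plaquetteHolonomy (extend3 hd U) x μ ν) 1 < ε
    rw [plaquetteHolonomy_extend3_of_le_left hd U x (not_lt.mp hμ), dist_self]; exact hε

/-- **Monopole numbers are preserved**: the cube of the extension spanned by the first three
directions carries the monopole number of the original cube. [folklore] -/
theorem monopole_extend3 (hd : 3 ≤ d) (U : GaugeConfig 3 L Circle) (x : Site d L) :
    monopole (extend3 hd U) x (Fin.castLE hd 0) (Fin.castLE hd 1) (Fin.castLE hd 2) =
      monopole U (proj3 hd x) 0 1 2 := by
  simp only [monopole, cob, abelianFieldTensor_extend3_castLE, proj3_shift_castLE]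

variable [NeZero L]

/-- **Fluxes are preserved** in the first three directions. [folklore] -/
theorem topCharge_extend3_castLE (hd : 3 ≤ d) (U : GaugeConfig 3 L Circle) (x₀ : Site d L)
    (i j : Fin 3) : topCharge x₀ (Fin.castLE hd i) (Fin.castLE hd j) (extend3 hd U) =
      topCharge (proj3 hd x₀) i j U := by
  simp only [topCharge, magneticFlux, abelianFieldTensor_extend3_castLE, proj3_add_single_castLE]

/-- **Fluxes vanish** on all other index pairs. [folklore] -/
theorem topCharge_extend3_eq_zero (hd : 3 ≤ d) (U : GaugeConfig 3 L Circle) (x₀ : Site d L)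
    {μ ν : Fin d} (h : 3 ≤ (μ : ℕ) ∨ 3 ≤ (ν : ℕ)) : topCharge x₀ μ ν (extend3 hd U) = 0 := by
  have hF : ∀ y : Site d L, abelianFieldTensor (extend3 hd U) y μ ν = 0 :=
    fun y => abelianFieldTensor_extend3_eq_zero hd U y h
  simp [topCharge, magneticFlux, hF]

/-! ## §2. The monopole crystal in `d ≥ 3` dimensions -/

/-- **The monopole crystal of the `d`-torus**, `d ≥ 3`, `L` even: the three-dimensional crystal of
`Scaling/MonopoleCrystal` extended trivially in the directions `3, …, d−1`. [folklore] -/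
def crystalLift (hd : 3 ≤ d) (hL : 2 ∣ L) : GaugeConfig d L Circle :=
  extend3 hd (crystal hL)

/-- The lifted crystal is `ε`-thin exactly for `ε > 1`. [folklore] -/
theorem crystalLift_mem_thinSet_iff (hd : 3 ≤ d) (hL : 2 ∣ L) {ε : ℝ} :
    crystalLift hd hL ∈ ThinSet d L ε ↔ 1 < ε := by
  refine ⟨fun h => ?_, fun h => extend3_mem_thinSet hd (by linarith) ((crystal_mem_thinSet_iff hL).mpr h)⟩
  have h1 := h ⟨0, ⟨(Fin.castLE hd 0, Fin.castLE hd 1), Fin.lt_def.mpr (by simp)⟩⟩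
  have hP : plaquetteHolonomy (crystalLift hd hL) 0 (Fin.castLE hd 0) (Fin.castLE hd 1) =
      plaquetteHolonomy (crystal hL) 0 0 1 := plaquetteHolonomy_extend3_castLE hd _ 0 0 1
  have h2 : dist (plaquetteHolonomy (crystalLift hd hL) 0 (Fin.castLE hd 0) (Fin.castLE hd 1)) 1 < ε :=
    h1
  rwa [hP, dist_plaquetteHolonomy_crystal_zero] at h2

/-- Every cube of the lifted crystal spanned by the first three directions carries monopole number
`±1`. [folklore] -/
theorem monopole_crystalLift (hd : 3 ≤ d) (hL : 2 ∣ L) (x : Site d L) :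
    monopole (crystalLift hd hL) x (Fin.castLE hd 0) (Fin.castLE hd 1) (Fin.castLE hd 2) =
      chi hL (proj3 hd x) := by
  rw [crystalLift, monopole_extend3, monopole_crystal]

/-- Every flux of the lifted crystal vanishes. [folklore] -/
theorem topCharge_crystalLift (hd : 3 ≤ d) (hL : 2 ∣ L) (x₀ : Site d L) (μ ν : Fin d) :
    topCharge x₀ μ ν (crystalLift hd hL) = 0 := by
  by_cases hμ : (μ : ℕ) < 3
  · by_cases hν : (ν : ℕ) < 3
    · obtain ⟨i, rfl⟩ := exists_eq_castLE hd hμ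
      obtain ⟨j, rfl⟩ := exists_eq_castLE hd hν
      rw [crystalLift, topCharge_extend3_castLE, topCharge_crystal]
    · exact topCharge_extend3_eq_zero hd _ x₀ (Or.inr (not_lt.mp hν))
  · exact topCharge_extend3_eq_zero hd _ x₀ (Or.inl (not_lt.mp hμ))

/-- **The lifted crystal is not in the `ε`-sector of the vacuum**, `ε ≤ 2`. [folklore] -/
theorem crystalLift_not_mem_connectedComponentIn_one (hd : 3 ≤ d) (hL : 2 ∣ L) {ε : ℝ}
    (hε : ε ≤ 2) : crystalLift hd hL ∉ connectedComponentIn (ThinSet d L ε) 1 := fun h => by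
  have h1 := monopole_eq_of_mem_connectedComponentIn hε h 0 (Fin.castLE hd 0) (Fin.castLE hd 1)
    (Fin.castLE hd 2)
  rw [monopole_crystalLift, monopole_one] at h1
  exact chi_ne_zero hL _ h1

/-- **C10 (d) in every dimension `d ≥ 3`: for `1 < ε ≤ 2` the `ε`-sector partition is STRICTLY
FINER than the flux partition** (every even `L ≥ 2`). [folklore] -/
theorem exists_thin_sameFlux_not_connected_of_le (hd : 3 ≤ d) (hL : 2 ∣ L) {ε : ℝ} (h1 : 1 < ε)
    (h2 : ε ≤ 2) : ∃ U U' : GaugeConfig d L Circle, U ∈ ThinSet d L ε ∧ U' ∈ ThinSet d L ε ∧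
      (∀ (x₀ : Site d L) (μ ν : Fin d), topCharge x₀ μ ν U = topCharge x₀ μ ν U') ∧
      (∃ (x : Site d L) (ν ρ σ : Fin d), monopole U' x ν ρ σ ≠ monopole U x ν ρ σ) ∧
      U' ∉ connectedComponentIn (ThinSet d L ε) U :=
  ⟨1, crystalLift hd hL, one_mem_thinSet (by linarith), (crystalLift_mem_thinSet_iff hd hL).mpr h1,
    fun x₀ μ ν => by rw [topCharge_one', topCharge_crystalLift],
    ⟨0, Fin.castLE hd 0, Fin.castLE hd 1, Fin.castLE hd 2, by
      rw [monopole_crystalLift, monopole_one]; exact chi_ne_zero hL _⟩,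
    crystalLift_not_mem_connectedComponentIn_one hd hL h2⟩

/-- Conjecture C10 (d) of the cell's THEORY-2 §4 (sharpness of the monopole threshold `ε = 1`), as a
closed statement: in every dimension `d ≥ 3`, on every even torus and for every `1 < ε ≤ 2`, the
trivial flux sector of the `ε`-thin set contains a configuration outside the `ε`-sector of the
vacuum. [folklore] -/
def MonopoleThresholdSharp : Prop :=
  ∀ (d L : ℕ) [NeZero L], 3 ≤ d → 2 ∣ L → ∀ ε : ℝ, 1 < ε → ε ≤ 2 →
    ∃ U : GaugeConfig d L Circle, U ∈ ThinSet d L ε ∧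
      (∀ (x₀ : Site d L) (μ ν : Fin d), topCharge x₀ μ ν U = 0) ∧
      U ∉ connectedComponentIn (ThinSet d L ε) 1

/-- **C10 (d) holds in every dimension `d ≥ 3`** (every even `L ≥ 2`). [folklore] -/
theorem monopoleThresholdSharp : MonopoleThresholdSharp :=
  fun _ _ _ hd hL _ h1 h2 => ⟨crystalLift hd hL, (crystalLift_mem_thinSet_iff hd hL).mpr h1,
    topCharge_crystalLift hd hL, crystalLift_not_mem_connectedComponentIn_one hd hL h2⟩

end Summit.Ventures.LatticeQCDFlow.Theory2.Lattice.Flux.MonopoleSectors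

end
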